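import Summits.QuantumFields.YangMills.Theorems.BalabanUVNodesN19KeyedCoreEdgeHolderD4TrimmedK3V5
import Literature.MathematicalPhysics.QuantumFieldTheory.Balaban1983to89.Node00.Record13SepCoPHV

/-!
# BalabanUVNodes ∕ N19 — THE SLOT EDITION OF THE N19′ FACE AND K3⁸ `SpineGivenEndpointR13SepCoPHV` (stmt-QuantumFields-27366) BY NAME, CONDITIONALLY: at EVERY version slot
# `v : Node00.Revision₁₃ F 2 θ h` (director-ym №210 (δⱽ), route rev 28∕29), the n19-w3 road's (B)-free N19′ face (sibling `…TrimmedK3V5` ★★★, p623655) IS the slot face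
# `KeyedCoreEdgeHolderD4V β cr (rrOfRecord 𝔯 ksel)` of plan g85's K3 «v6» (text spelled; one line, `h.toCore`), and — with stub 1's rates face and stub 2's N27x face in their (B)-FREE
# shapes, N20 ∕ N21 at `cr` — this seat's GENERIC composer `forall_keyed_hybridNE7Under_of_fscFacesP` (p595910) at the SLOT KEY gives `HybridNE7Under` of the slot datum per tuple and
# K3⁸'s statement CONDITIONALLY; the owed «slot edition» of this lineage's by-name producers (K3⁸'s docstring: «by-name face producers keyed slot-free owe slot editions»)

Cell `pub-ymgap`, HUMAN RULING D-0062 (Track A), WIDTH SEAT `pub-ymgap-dag-n19-w3` (N19 NE7, seat 3 of 3), generation g4; bus CLAIM-4 ∕ INTENT-4.  Cluster item **K3⁸ «SpineGivenEndpointR13SepCoPHV»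
(stmt-QuantumFields-27366)**, born at route rev 28 (chair R463, plan g85 SHAPE-SHEET-REV28, dag-lead KEY MAP v2 ∕ GATE v1.69); K3⁷ stmt-QuantumFields-20544 ASIDE (its v5 skeleton
941dddb108cbaacf and this lineage's 20544-keyed files stay as history ∕ supplier roads).  Filed `--kind proof --supports stmt-QuantumFields-27366 --as helper` (proves no registered stub; K3
«v6» not yet registered at filing).  COUNT-NEUTRAL.  THEOREMS ONLY; 0 `def`; 0 `sorry`; `N = 2`, the item guard, reading-generic `cr`.  Imports the sibling `…TrimmedK3V5` (this seat g4,
p623655) and DEF-1's `Literature/…/Node00/Record13SepCoPHV` (p620607: `Revision₁₃`, `datumOfRecord₁₃SepCoPHV`, the `rfl` faces) — CITED BY NAME, none edited; the K3 «v6» §1V texts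
(`KeyedCoreEdgeHolderD4V`, `KeyedRatesHolderD4BFree`, `KeyedExtractionBFree`; plan kit `D85-REV28/k3v6/K3Skeleton13SepCoPHv6.lean`, dag-n17-w2's probe §2) are SPELLED here, not
minted (dag-n27-w1 mints the by-name mirror `…K3V6Defs` after op 5; a one-import by-name re-point follows then).

WHAT THIS FILE PROVES (section hypotheses `hG16`, `hβ1`, `hβw`, `hlinkTrim` as in the sibling; theorem binders `hβ23`, the letter rows `hs hL h9 hWall`, and for §2∕§3 the (B)-free
faces `hrBFree` (stub 1's rates face, «v6» `KeyedRatesHolderD4BFree β (rrOfRecord 𝔯 ksel)` spelled — what dag-n27-w1's bill `keyedRatesHolderD4_rrOfRecord_of_pins_of_letters` proves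
in substance via `ForSmallCouplings.of_forall`), `h20 : KeyedRelWeight cr`, `h21 : KeyedShellWeight cr`, `hxBFree` («v6» `KeyedExtractionBFree cr` spelled) — ALL HYPOTHESES):
§1 ★★★ `keyedCoreEdgeHolderD4V_rrOfRecord_of_guardedReadingN16_letters_trimmedLinkReading` — «v6»'s slot face `KeyedCoreEdgeHolderD4V β cr (rrOfRecord 𝔯 ksel)` SPELLED, at EVERY
`v`: ONE line over the sibling's (B)-free theorem at `h.toCore` (the sheet's `keyedCoreEdgeHolderD4V_of_bFree`; the slot datum's `ForSmallCouplings` ∕ `PHolderD4` are the record's by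
DEF-1's `rfl` faces).
§2 ★★ `hybridNE7Under_datumOfRecord₁₃SepCoPHV_of_guardedReadingN16_bFreeFaces_letters_trimmedLinkReading` — per slot tuple `(F, θ, h, v)` with the item guard:
`HybridNE7Under (datumOfRecord₁₃SepCoPHV F 2 θ h v) (EndpointExistence (datumOfRecord₁₃SepCoPHV F 2 θ h v).C.toB12)` — `forall_keyed_hybridNE7Under_of_fscFacesP` (p595910) at
`Θ F := Σ' θ h, Revision₁₃ F 2 θ h`, `datumOf := datumOfRecord₁₃SepCoPHV`, readings at `h.toCore`, the three prefixed faces supplied (B)-free (prefix binders discarded).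
§3 ★★ `spineGivenEndpointR13SepCoPHV_of_guardedReadingN16_bFreeFaces_letters_trimmedLinkReading` — **K3⁸'s statement `…Theses.BalabanUVNodes.SpineGivenEndpointR13SepCoPHV` BY NAME,
CONDITIONALLY** — THE N19′-SIDE BILL OF K3⁸ IN STUB 1's VOCABULARY: v5∕«v6»'s key `GuardedReadingN16`, `2∕3 < β ≤ 1`, K1⁷'s window `hβw`, def-W1's letter rows `hs hL h9` + `hWall`,
NODE O's trimmed ledger reading `hlinkTrim` (0∕1 inhabited), stub 1's rates face and stub 2's N27x face (B)-free, stub 2's N20 ∕ N21 faces at `cr`.  `proof.conditional`, credits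
nothing; NOT a proof of K3⁸.

HONEST FRAMING.  Count-neutral kernel bookkeeping; every antecedent is a HYPOTHESIS; §3 is a CONDITIONAL reading of the crux's statement, NOT a proof of it — K3⁸ stmt-QuantumFields-27366
stays OPEN and UNCLAIMED, no stub is proved, no skeleton touched; nothing of Bałaban's asserted or instantiated (K0⁷ OPEN; the slot `v` re-chooses densities a.e., it proves no estimate);
NE7 ∕ NE9 ∕ (5.10)-at-the-record NOT PRINTED as two-run statements ∕ NOT proved; N14 ∕ N16 ∕ N19 ∕ N22 NOT discharged; A6: at THE END's letter recipe of record the kept radii rows of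
`hlinkTrim` are unsatisfiable (dag-n21-w6 p614571) — plan's (t-N16b) word; counts unmoved (typed 28∕28 · discharged 5∕27 · A 5∕28).  One finite four-torus at fixed ε — R4 closes the
CONDITIONAL finite-𝕋⁴ rung `BalabanLadder.UV` only; NOT infinite volume ∕ OS ∕ mass gap; the YM mass gap (Clay) is NOT proved by any of this.  Standard axioms.  Edits nothing.
-/

set_option autoImplicit false

noncomputable section

open Finset MeasureTheory
open scoped BigOperators Matrix Matrix.Norms.L2Operator

namespace Summit.QuantumFields.YangMills.BalabanUVNodes.N19KeyedCoreEdgeHolderD4SlotK3R8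


open Literature.MathematicalPhysics.QuantumFieldTheory.Balaban1983to89
open T4OutputRate T4RecentScale T4GoodClassBudget T4CauchySum T4TowerRateComposition T4TowerRateDischarge
open T4EtaRateMin (Readings NE3Shape)
open T4RateLiaison (GaugeDominated)
open FlowStep (RGEqH prefixOf)
open TreeLengthTorus (TFaceConnected torusTreeLen)
open B12TreeDecay (kappa₀)
open Summit.QuantumFields.BalabanUV.T4Continuum
open AveragingDeficitDualResidual (dualC1 dualC2)
open AveragingDeficitDerivWallProof (wallConst)
open AveragingDeficitPeriodicCounting (IsPeriodicDir)
open MinimalActionSandwich (IsMinimiser minAct)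
open MinimalActionRate (sfClass)
open MinimalActionRefine (RegularSup gradConst)
open NE3EnergyShapes (IsUnitarySite IsPeriodicSite)
open NE3.LeafIndexSockets (LeafH3sup)
open Summit.QuantumFields.BalabanUV.T4Continuum.Spine
open Summit.QuantumFields.BalabanUV.T4Continuum.Spine.NE4 (runFlow)
open Summit.QuantumFields.BalabanUV.T4Continuum.NE1p.DressedRoot (DressedTower DressedStabilityStrict)
open Summit.QuantumFields.YangMills.BalabanUVNodes.N19LedgerLinkSync (LedgerDataSync LedgerAtSync)
open YMDAG.UVSplit (SpineCarriers SpineRecordPred InputsPred U3Carriers RateCarriers RateRecordPred N14At N18At N22At ReadOutAt)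
open Summit.QuantumFields.YangMills.BalabanUVNodes.N16HolderDefs (CovRootHolder N16HolderAt)
open Summit.QuantumFields.YangMills.BalabanUVNodes.SpineRatesHolder (RatesHolderAt)
open Literature.MathematicalPhysics.QuantumFieldTheory.Balaban1983to89.T4Continuum (T4Family ULoop)
open YMDAG.UVSplit (Datum RateReading₁₃CoPH rateCarriersOfRecord₁₃CoPH ne3OfRecord₁₁)
open Node00 (Stage13HParams datumOfRecord₁₃CoPH SiteSeqKey NE3Letters₁₁ ne3ConstLayerOfRecord₁₁ ne3NperOfRecord₁₁ ne3DomOfRecord₁₁)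
open Summit.QuantumFields.YangMills.BalabanUVNodes.N16PinnedLayer13CoPH (N16PinnedLoose N16LettersEnd)
open YMDAG.N14.TopBorn (ne1OfRecord obsSupNorm)
open Node00 (U3Letters₁₁)
open Literature.MathematicalPhysics.QuantumFieldTheory.Balaban1983to89.Node00.U3OfKernels (objectsOfRecord₁₃)
open T4WeightBudget (RelWeightBound)
open T4IndicatorShell (ShellWeightBound)
open T4ContinuumYM4Torus (ForSmallCouplings)
open T4ApexHybrid (HybridNE7Under)
open Summit.QuantumFields.YangMills.Theorems.K3V5Defs (SpineReading RunSel LetterReading rrOfRecord PHolderD4 KeyedRatesHolderD4 GuardedReadingN16 KeyedRelWeight KeyedShellWeight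
  KeyedCoreEdgeHolderD4 KeyedExtraction)
open Literature.MathematicalPhysics.QuantumFieldTheory.Balaban1983to89.Node00.U3KernelLetters (PolLimitsExistOfRecord₁₃ WindowedNE9OfRecord₁₃ WindowedDecayOfRecord₁₃)
open Summit.QuantumFields.YangMills.BalabanUVNodes.N19KeyedCoreEdgeHolderD4LettersK3V5 (keyedCoreEdgeHolderD4_rrOfRecord_of_guardedReadingN16_letters_ledgerLinkReading
  hybridNE7Under_of_guardedReadingN16_keyedFaces_letters_ledgerLinkReading)
open Summit.QuantumFields.YangMills.BalabanUVNodes.N19RateEdgeHolderD4AtTrimmedLedgerReading (linkReadingAtLedgerReading_of_linkReadingAtTrimmedLedgerReading)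
open Summit.QuantumFields.YangMills.BalabanUVNodes.N19UniformLettersAtU3Pin (hunif_of_u3Pinned_of_signs)
open Summit.QuantumFields.YangMills.BalabanUVNodes.N19BundleDecayLetterFromStub1Rows (hdecT_of_u3Pinned_of_stub1Rows)
open Summit.QuantumFields.YangMills.BalabanUVNodes.N19RateEdgeHolderD4AtN16PinnedReadingFSC (forSmallCouplings_h19HolderD4_datumOfRecord₁₃CoPH_of_linkReadingAtN16PinnedReading)
open Summit.QuantumFields.YangMills.BalabanUVNodes.N19RateEdgeHolderD4AtPinnedReading (linkReadingAtN16PinnedReading_of_linkReadingAtPinnedReading)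
open Summit.QuantumFields.YangMills.BalabanUVNodes.N19RateEdgeHolderD4AtKeyedReading (linkReadingAtPinnedReading_of_linkReadingAtKeyedReading)
open Summit.QuantumFields.YangMills.BalabanUVNodes.N19RateEdgeHolderD4AtLedgerReading (linkReadingAtKeyedReading_of_linkReadingAtLedgerReading)

open Node00 (Revision₁₃ datumOfRecord₁₃SepCoPHV)
open Summit.QuantumFields.YangMills.BalabanUVNodes.N19CoreEdgeFSCComposer (forall_keyed_hybridNE7Under_of_fscFacesP)
open Summit.QuantumFields.YangMills.BalabanUVNodes.N19KeyedCoreEdgeHolderD4TrimmedK3V5 (keyedCoreEdgeHolderD4BFree_rrOfRecord_of_guardedReadingN16_letters_trimmedLinkReading)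

section Slot

variable (cr : SpineReading) (𝔯 : RateReading₁₃CoPH 2) (ksel : RunSel) (ℓ : LetterReading) (ℓ₃ : T4Family → NE3Letters₁₁) (g B : T4Family → ℝ) {β : ℝ} (hβ1 : β ≤ 1)
  (hG16 : GuardedReadingN16 𝔯 ksel ℓ ℓ₃ g B)
    (hβw : ∀ (F : T4Family) (θ : Stage13HParams F 2) (hP : θ.Provisos₁₃CoPH F 2), (θ.ZhUnity F 2 ∧ θ.SlotsNondegenerate₁₃ F 2) → θ.Admissible F 2 →
      ∃ γ₀ b b' : ℝ, 0 < γ₀ ∧ 0 < b ∧ DagBinding.BetaBoundsInInterval (datumOfRecord₁₃CoPH F 2 θ hP).C.toB12 γ₀ b b')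
  (hlinkTrim : ∀ (F : T4Family) (θ : Stage13HParams F 2) (hP : θ.Provisos₁₃CoPH F 2), (θ.ZhUnity F 2 ∧ θ.SlotsNondegenerate₁₃ F 2) → θ.Admissible F 2 →
    ∀ (γ gIR b : ℝ) (g₀ : ℕ → ℝ), (datumOfRecord₁₃CoPH F 2 θ hP).Tuned γ gIR g₀ → γ ≤ θ.γ → γ ^ 2 ≤ Real.exp (-1) → 0 < b →
    (∀ K m, 0 ≤ m → m < K → b ≤ (datumOfRecord₁₃CoPH F 2 θ hP).βfun m (prefixOf (runFlow (datumOfRecord₁₃CoPH F 2 θ hP) g₀ K) m)) →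
    ∀ (os : List (ULoop F)) (k : ℕ),
      let S : SpineCarriers := cr F θ hP g₀ os
      let R : RateCarriers 2 := rateCarriersOfRecord₁₃CoPH 𝔯 F θ hP g₀ os k
      let D : Datum F 2 := datumOfRecord₁₃CoPH F 2 θ hP
      letI := S.dec
      ∃ (_ : DecidableEq R.u3.C.Dom) (F' : Type) (ι' X' : Type) (_ : MeasurableSpace ι')
        (L : LedgerDataSync R.u3.C F' ι' S.ι) (Rd : Readings ι' X') (bsel : (ℕ → ℝ) → ℝ) (EB : Functional R.u3.C R.u3.C.BgB)
        (g : ℕ → ℕ → ℝ)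
        (uA : ℕ → ι' → R.u3.C.BgA) (uB : ℕ → ι' → R.u3.C.BgB)
        (Pf : ℕ → Params) (d₀ L₀ Koff : ℕ) (cells : (K j : ℕ) → R.u3.C.Dom → Finset (Site (Pf K) j))
        (H033 : Flow → ℕ → Prop) (I : Type) (fam : I → B14.Sect2Data) (Lb βw : ℝ) (κ₁ : ℕ) (Gv Cl : ℝ) (K₁ : ℕ)
        (c' t θ : ℝ)
        (sel : ℕ → (B7Prop1Explicit.Site 4 → Fin 4 → (Matrix (Fin 2) (Fin 2) ℂ)ˣ) → (B7Prop1Explicit.Site 4 → Fin 4 → (Matrix (Fin 2) (Fin 2) ℂ)ˣ))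
        (rd : ι' → (B7Prop1Explicit.Site 4 → Fin 4 → (Matrix (Fin 2) (Fin 2) ℂ)ˣ)),
        (∀ K i, i ≤ K → g K i = runFlow D g₀ K i) ∧ (∀ K i, K < i → g K i = gIR) ∧
        EB = (fun s => R.u3.EB (bsel s) s) ∧
        (∀ (Sz : ℕ → ℝ → S.ι → ℕ → ℝ) (E₀ : ℝ) (m : ℕ) (a : ℝ) (Cw Λg : ℝ),
          (∀ K t, |t| ≤ S.l₀ → ∀ τ ∈ S.T K \ S.Bad K t, ∀ v ∈ Rd.dom, ∀ j ≤ K,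
            |∑ X ∈ L.fac K t τ with R.u3.C.scale X = j,
                (Real.log (Real.exp (EB (fun i => g (K + 1) (i + 1)) (uB K v) X
                    - EB (fun i => g (K + 1) (i + 1)) L.oneB X))
                  - Real.log (Real.exp (R.u3.EA (g K) (uA K v) X - R.u3.EA (g K) L.oneA X)))| ≤ Sz K t τ j) →
          0 ≤ E₀ → 0 < a → a < 1 →
          (∀ K t, |t| ≤ S.l₀ → ∀ τ ∈ S.T K \ S.Bad K t, ∀ j ≤ K,
            Sz K t τ j ≤ S.vol * (E₀ * ((K : ℝ) + 1) ^ m * a ^ (K - j))) →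
          (∀ K, Multiplicity (L.All K) R.u3.C.scale (fun X => Real.exp (-(R.u3.κ * R.u3.C.d X))) Cw S.vol Λg K) →
          (∀ K t, |t| ≤ S.l₀ → ∀ τ ∈ S.T K \ S.Bad K t,
            WindowMultiplicity (L.facO K t τ) L.scO L.wO Cw S.vol Λg (jlogOf L.Cl K) K) →
          1 ≤ Λg → L.θ' ≤ Λg →
          LedgerAtSync { L with S := Sz, E₀ := E₀, m := m, a := a, Cw := Cw, Λg := Λg } S.l₀ S.vol S.T S.Bad
            (fun K t τ => S.A K t τ - S.shA K t τ) (fun K t τ => S.B K t τ - S.shB K t τ) Rd R.u3.EA EB R.u3.κ g uA uB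
            R.u3.ω R.u3.ρ R.u3.θ (θ ^ ((3 : ℝ) * β - 2))) ∧
        0 ≤ S.vol ∧
        (∀ K t, |t| ≤ S.l₀ → ∀ τ ∈ S.T K \ S.Bad K t,
          WindowMultiplicity (L.facO K t τ) L.scO L.wO L.Cw S.vol L.Λg (jlogOf L.Cl K) K) ∧
        0 ≤ L.Cw ∧ 1 ≤ L.Λg ∧ L.θ' ≤ L.Λg ∧
        (∀ K, (Pf K).d = d₀) ∧ (∀ K, (Pf K).L = L₀) ∧ (∀ K, (Pf K).K = Koff + K) ∧
        (∀ K, (Fintype.card (Site (Pf K) (Pf K).K) : ℝ) = S.vol) ∧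
        kappa₀ (4 * 2 ^ d₀) (2 * d₀) ≤ R.u3.κ ∧
        (∀ K, ∀ X ∈ L.All K,
          (cells K (R.u3.C.scale X + Koff) X).Nonempty ∧ TFaceConnected (cells K (R.u3.C.scale X + Koff) X)) ∧
        (∀ K j, Set.InjOn (cells K j) ↑((L.All K).filter fun X => R.u3.C.scale X + Koff = j)) ∧
        (∀ K, ∀ X ∈ L.All K, torusTreeLen (cells K (R.u3.C.scale X + Koff) X) ≤ R.u3.C.d X) ∧
        B14.Thm2Printed H033 fam Lb βw κ₁ ∧ βw < 1 ∧ 0 < βw ∧ 1 < Lb ∧ 1 ≤ Gv ∧ 0 ≤ Cl ∧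
        (∀ K t, |t| ≤ S.l₀ → ∀ τ ∈ S.T K \ S.Bad K t, ∀ j ≤ K, ∃ (i : I) (w : (fam i).Ω) (j' : ℕ),
          (fam i).flow.SatisfiesRG (fam i).K ∧ H033 (fam i).flow (fam i).K ∧ 1 ≤ j' ∧ j' ≤ (fam i).K ∧
          (fam i).K - j' = K - j ∧ (fam i).K ≤ K + K₁ ∧
          (∀ n, 0 ≤ (fam i).gammaVol n w) ∧ (fam i).gammaVol (fam i).K w ≤ S.vol ∧
          (∀ n, n < (fam i).K → n < jlogOf Cl (fam i).K → (fam i).gammaVol n w = 0) ∧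
          (∀ n, n < (fam i).K → jlogOf Cl (fam i).K ≤ n → (fam i).gammaVol n w ≤ S.vol * Gv ^ ((fam i).K - n))) ∧
        R.ne3.g = gradConst 4 c' ∧ 0 ≤ c' ∧ R.ne3.b ≤ t ∧ c' ≤ t ∧
        (2 : ℝ) ^ 91 * (R.ne3.L : ℝ) ^ 17 * t ≤ 1 ∧ (2 : ℝ) ^ 76 * (R.ne3.L : ℝ) ^ 12 * t ≤ R.ne3.ε ∧
        16 * B7Prop2Explicit.C0 4 * R.ne3.ε ≤ 3 ∧ 1024 * (4 + 1) * (4 + 4) * (R.ne3.L : ℝ) ^ 2 * R.ne3.ε ≤ 1 ∧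
        4 * ((ℓ₃ F).ε / B F) ≤ c' ∧
        LeafH3sup 4 R.ne3.L R.ne3.Nper R.ne3.ε R.ne3.b c' R.ne3.dom ∧
        (∀ V ∈ R.ne3.dom, ∀ k : ℕ, IsMinimiser 4 (sfClass 4 R.ne3.L R.ne3.Nper R.ne3.ε) R.ne3.L R.ne3.Nper k V (sel k V)) ∧
        (∀ V ∈ R.ne3.dom, ∀ k : ℕ, RegularSup 4 R.ne3.L R.ne3.Nper R.ne3.b c' k (sel k V)) ∧
        0 < θ ∧ θ ^ 6 = ((R.ne3.L : ℝ))⁻¹ ∧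
        (∀ v ∈ Rd.dom, rd v ∈ R.ne3.dom) ∧
        (∀ k, ∀ v ∈ Rd.dom, Rd.act k v = minAct 4 (sfClass 4 R.ne3.L R.ne3.Nper R.ne3.ε) R.ne3.L R.ne3.Nper k (rd v)) ∧
        (R.ne3.Nper : ℝ) ^ 4 ≤ Rd.vol ∧
        (∀ s ∈ Window γ, 0 < bsel s ∧ bsel s ≤ γ))

include hβ1 hG16 hβw hlinkTrim

/-! ## §1 The slot face of the N19′ conjunct at every version `v` -/

/-- ★★★ **K3 «v6»'s SLOT FACE `KeyedCoreEdgeHolderD4V β cr (rrOfRecord 𝔯 ksel)` (text spelled) AT EVERY VERSION SLOT `v`** [bookkeeping]: ONE line over the sibling's (B)-free theorem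
read at `h.toCore` — the sheet's `keyedCoreEdgeHolderD4V_of_bFree`; the slot datum's `ForSmallCouplings` ∕ `PHolderD4` ARE the record's by DEF-1's `rfl` faces, (B) ∕ END at the slot are
unread binders.  ONE FACE of «v6»'s stub 2 modulo displayed hypotheses — NOT the stub, NOT K3⁸; N14 ∕ N16 ∕ N19 ∕ N22 NOT discharged. -/
theorem keyedCoreEdgeHolderD4V_rrOfRecord_of_guardedReadingN16_letters_trimmedLinkReading (hβ23 : 2 / 3 < β)
    (hs : ∀ (F : T4Family) (θ : Stage13HParams F 2), θ.Provisos₁₃CoPH F 2 → (θ.ZhUnity F 2 ∧ θ.SlotsNondegenerate₁₃ F 2) → θ.Admissible F 2 → (ℓ F θ).Signs)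
    (hL : ∀ (F : T4Family) (θ : Stage13HParams F 2), θ.Provisos₁₃CoPH F 2 → (θ.ZhUnity F 2 ∧ θ.SlotsNondegenerate₁₃ F 2) → θ.Admissible F 2 →
      PolLimitsExistOfRecord₁₃ F 2 θ.toStage13Params)
    (h9 : ∀ (F : T4Family) (θ : Stage13HParams F 2), θ.Provisos₁₃CoPH F 2 → (θ.ZhUnity F 2 ∧ θ.SlotsNondegenerate₁₃ F 2) → θ.Admissible F 2 →
      WindowedNE9OfRecord₁₃ F 2 θ.toStage13Params (ℓ F θ).κ (ℓ F θ).moduli)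
    (hWall : ∀ (μ ν : Fin 4) (F : T4Family) (θ : Stage13HParams F 2), θ.Provisos₁₃CoPH F 2 → (θ.ZhUnity F 2 ∧ θ.SlotsNondegenerate₁₃ F 2) → θ.Admissible F 2 →
      WindowedDecayOfRecord₁₃ F 2 θ.toStage13Params μ ν (ℓ F θ).κ) :
    ∀ (F : T4Family) (θ : Stage13HParams F 2) (h : θ.Provisos₁₃SepCoPH F 2) (v : Revision₁₃ F 2 θ h), (θ.ZhUnity F 2 ∧ θ.SlotsNondegenerate₁₃ F 2) → θ.Admissible F 2 →
      B16.EndStatementBPrinted (datumOfRecord₁₃SepCoPHV F 2 θ h v).C → DagBinding.EndpointExistence (datumOfRecord₁₃SepCoPHV F 2 θ h v).C.toB12 →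
        ForSmallCouplings (datumOfRecord₁₃SepCoPHV F 2 θ h v) fun g₀ => ∀ os : List (ULoop F),
          PHolderD4 β (datumOfRecord₁₃SepCoPHV F 2 θ h v) (rrOfRecord 𝔯 ksel F θ h.toCore g₀ os) → letI := (cr F θ h.toCore g₀ os).dec
            ∃ δ : ℕ → ℝ, NE7.Core (cr F θ h.toCore g₀ os).l₀ (cr F θ h.toCore g₀ os).vol (cr F θ h.toCore g₀ os).T (cr F θ h.toCore g₀ os).Bad
              (fun K t τ => (cr F θ h.toCore g₀ os).A K t τ - (cr F θ h.toCore g₀ os).shA K t τ)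
              (fun K t τ => (cr F θ h.toCore g₀ os).B K t τ - (cr F θ h.toCore g₀ os).shB K t τ) δ ∧ Summable δ :=
  fun F θ h _ hGd hθ _ _ =>
    keyedCoreEdgeHolderD4BFree_rrOfRecord_of_guardedReadingN16_letters_trimmedLinkReading cr 𝔯 ksel ℓ ℓ₃ g B hβ1 hG16 hβw hlinkTrim hβ23 hs hL h9 hWall F θ h.toCore hGd hθ

/-! ## §2 `HybridNE7Under` of the SLOT datum from the (B)-free faces — the generic composer at the slot key -/

/-- ★★ **`HybridNE7Under (datumOfRecord₁₃SepCoPHV F 2 θ h v) (EndpointExistence …)` PER SLOT TUPLE FROM THE (B)-FREE FACES** [bookkeeping]: this seat's GENERIC composer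
`forall_keyed_hybridNE7Under_of_fscFacesP` (p595910) at `Θ F := Σ' θ h, Revision₁₃ F 2 θ h`, `datumOf := datumOfRecord₁₃SepCoPHV`, readings at `h.toCore`, `P := PHolderD4 β`; N20 ∕ N21 at
`cr` (version-free), stub 1's rates face `hrBFree`, the N19′ face (sibling ★★★) and the N27x face `hxBFree` (B)-FREE — each prefixed slot face is the (B)-free one with its two binders
discarded (DEF-1's `rfl` faces).  Hypotheses displayed; NOT K3⁸; no stub proved; N19 NOT discharged. -/
theorem hybridNE7Under_datumOfRecord₁₃SepCoPHV_of_guardedReadingN16_bFreeFaces_letters_trimmedLinkReading (hβ23 : 2 / 3 < β)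
    (hs : ∀ (F : T4Family) (θ : Stage13HParams F 2), θ.Provisos₁₃CoPH F 2 → (θ.ZhUnity F 2 ∧ θ.SlotsNondegenerate₁₃ F 2) → θ.Admissible F 2 → (ℓ F θ).Signs)
    (hL : ∀ (F : T4Family) (θ : Stage13HParams F 2), θ.Provisos₁₃CoPH F 2 → (θ.ZhUnity F 2 ∧ θ.SlotsNondegenerate₁₃ F 2) → θ.Admissible F 2 →
      PolLimitsExistOfRecord₁₃ F 2 θ.toStage13Params)
    (h9 : ∀ (F : T4Family) (θ : Stage13HParams F 2), θ.Provisos₁₃CoPH F 2 → (θ.ZhUnity F 2 ∧ θ.SlotsNondegenerate₁₃ F 2) → θ.Admissible F 2 →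
      WindowedNE9OfRecord₁₃ F 2 θ.toStage13Params (ℓ F θ).κ (ℓ F θ).moduli)
    (hWall : ∀ (μ ν : Fin 4) (F : T4Family) (θ : Stage13HParams F 2), θ.Provisos₁₃CoPH F 2 → (θ.ZhUnity F 2 ∧ θ.SlotsNondegenerate₁₃ F 2) → θ.Admissible F 2 →
      WindowedDecayOfRecord₁₃ F 2 θ.toStage13Params μ ν (ℓ F θ).κ)
    (hrBFree : ∀ (F : T4Family) (θ : Stage13HParams F 2) (hP : θ.Provisos₁₃CoPH F 2), (θ.ZhUnity F 2 ∧ θ.SlotsNondegenerate₁₃ F 2) → θ.Admissible F 2 →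
      ForSmallCouplings (datumOfRecord₁₃CoPH F 2 θ hP) fun g₀ => ∀ os : List (ULoop F), PHolderD4 β (datumOfRecord₁₃CoPH F 2 θ hP) (rrOfRecord 𝔯 ksel F θ hP g₀ os))
    (h20 : KeyedRelWeight cr) (h21 : KeyedShellWeight cr)
    (hxBFree : ∀ (F : T4Family) (θ : Stage13HParams F 2) (hP : θ.Provisos₁₃CoPH F 2), (θ.ZhUnity F 2 ∧ θ.SlotsNondegenerate₁₃ F 2) → θ.Admissible F 2 →
      ForSmallCouplings (datumOfRecord₁₃CoPH F 2 θ hP) fun g₀ => ∀ os : List (ULoop F),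
        0 < (cr F θ hP g₀ os).l₀ ∧ 0 < (cr F θ hP g₀ os).vol ∧
        (∀ (K : ℕ) (t : ℝ), |t| ≤ (cr F θ hP g₀ os).l₀ →
          T4GenFunBounds.schemeZ ((datumOfRecord₁₃CoPH F 2 θ hP).scheme g₀) os ((cr F θ hP g₀ os).K₀ + K) t = ∑ τ ∈ (cr F θ hP g₀ os).T K, (cr F θ hP g₀ os).A K t τ) ∧
        (∀ (K : ℕ) (t : ℝ), |t| ≤ (cr F θ hP g₀ os).l₀ →
          T4GenFunBounds.schemeZ ((datumOfRecord₁₃CoPH F 2 θ hP).scheme g₀) os ((cr F θ hP g₀ os).K₀ + K + 1) t = ∑ τ ∈ (cr F θ hP g₀ os).T K, (cr F θ hP g₀ os).B K t τ))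
    (F : T4Family) (θ : Stage13HParams F 2) (h : θ.Provisos₁₃SepCoPH F 2) (v : Revision₁₃ F 2 θ h) (hGd : θ.ZhUnity F 2 ∧ θ.SlotsNondegenerate₁₃ F 2) (hθ : θ.Admissible F 2) :
    HybridNE7Under (datumOfRecord₁₃SepCoPHV F 2 θ h v) (DagBinding.EndpointExistence (datumOfRecord₁₃SepCoPHV F 2 θ h v).C.toB12) :=
  forall_keyed_hybridNE7Under_of_fscFacesP (Θ := fun F => Σ' (θ : Stage13HParams F 2) (h : θ.Provisos₁₃SepCoPH F 2), Revision₁₃ F 2 θ h) (fun _ => True)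
    (fun θv => (θv.1.ZhUnity _ 2 ∧ θv.1.SlotsNondegenerate₁₃ _ 2) ∧ θv.1.Admissible _ 2) (fun θv _ => datumOfRecord₁₃SepCoPHV _ 2 θv.1 θv.2.1 θv.2.2)
    (fun θv _ => cr _ θv.1 θv.2.1.toCore) (fun θv _ => rrOfRecord 𝔯 ksel _ θv.1 θv.2.1.toCore) (PHolderD4 β)
    (fun F θv _ hA => h20 F θv.1 θv.2.1.toCore hA.1 hA.2) (fun F θv _ hA => h21 F θv.1 θv.2.1.toCore hA.1 hA.2)
    (fun F θv _ hA _ _ => hrBFree F θv.1 θv.2.1.toCore hA.1 hA.2)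
    (fun F θv _ hA _ _ =>
      keyedCoreEdgeHolderD4BFree_rrOfRecord_of_guardedReadingN16_letters_trimmedLinkReading cr 𝔯 ksel ℓ ℓ₃ g B hβ1 hG16 hβw hlinkTrim hβ23 hs hL h9 hWall F θv.1
        θv.2.1.toCore hA.1 hA.2)
    (fun F θv _ hA _ _ => hxBFree F θv.1 θv.2.1.toCore hA.1 hA.2) F ⟨θ, h, v⟩ trivial ⟨hGd, hθ⟩

/-! ## §3 K3⁸ by name, conditionally -/

/-- ★★ **K3⁸'s STATEMENT BY NAME, CONDITIONALLY — THE N19′-SIDE BILL OF `SpineGivenEndpointR13SepCoPHV` (stmt-QuantumFields-27366) IN STUB 1's VOCABULARY** [bookkeeping]: from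
the displayed HYPOTHESES — v5∕«v6»'s key `GuardedReadingN16`, `2∕3 < β ≤ 1`, K1⁷'s window `hβw`, def-W1's letter rows `hs hL h9` + the ∀μν windowed (5.10) letter `hWall`, NODE O's
TRIMMED ledger reading `hlinkTrim` (0∕1 inhabited), stub 1's rates face `hrBFree` and stub 2's N27x face `hxBFree` in their (B)-free shapes, stub 2's `KeyedRelWeight cr` ∕
`KeyedShellWeight cr` — §2 at every slot tuple, the slot's own (B) ∕ END binders discarded.  A CONDITIONAL reading of the crux; NOT a proof of K3⁸ (OPEN, unclaimed); no stub proved;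
nothing of Bałaban asserted; N19 NOT discharged; counts unmoved. -/
theorem spineGivenEndpointR13SepCoPHV_of_guardedReadingN16_bFreeFaces_letters_trimmedLinkReading (hβ23 : 2 / 3 < β)
    (hs : ∀ (F : T4Family) (θ : Stage13HParams F 2), θ.Provisos₁₃CoPH F 2 → (θ.ZhUnity F 2 ∧ θ.SlotsNondegenerate₁₃ F 2) → θ.Admissible F 2 → (ℓ F θ).Signs)
    (hL : ∀ (F : T4Family) (θ : Stage13HParams F 2), θ.Provisos₁₃CoPH F 2 → (θ.ZhUnity F 2 ∧ θ.SlotsNondegenerate₁₃ F 2) → θ.Admissible F 2 →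
      PolLimitsExistOfRecord₁₃ F 2 θ.toStage13Params)
    (h9 : ∀ (F : T4Family) (θ : Stage13HParams F 2), θ.Provisos₁₃CoPH F 2 → (θ.ZhUnity F 2 ∧ θ.SlotsNondegenerate₁₃ F 2) → θ.Admissible F 2 →
      WindowedNE9OfRecord₁₃ F 2 θ.toStage13Params (ℓ F θ).κ (ℓ F θ).moduli)
    (hWall : ∀ (μ ν : Fin 4) (F : T4Family) (θ : Stage13HParams F 2), θ.Provisos₁₃CoPH F 2 → (θ.ZhUnity F 2 ∧ θ.SlotsNondegenerate₁₃ F 2) → θ.Admissible F 2 →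
      WindowedDecayOfRecord₁₃ F 2 θ.toStage13Params μ ν (ℓ F θ).κ)
    (hrBFree : ∀ (F : T4Family) (θ : Stage13HParams F 2) (hP : θ.Provisos₁₃CoPH F 2), (θ.ZhUnity F 2 ∧ θ.SlotsNondegenerate₁₃ F 2) → θ.Admissible F 2 →
      ForSmallCouplings (datumOfRecord₁₃CoPH F 2 θ hP) fun g₀ => ∀ os : List (ULoop F), PHolderD4 β (datumOfRecord₁₃CoPH F 2 θ hP) (rrOfRecord 𝔯 ksel F θ hP g₀ os))
    (h20 : KeyedRelWeight cr) (h21 : KeyedShellWeight cr)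
    (hxBFree : ∀ (F : T4Family) (θ : Stage13HParams F 2) (hP : θ.Provisos₁₃CoPH F 2), (θ.ZhUnity F 2 ∧ θ.SlotsNondegenerate₁₃ F 2) → θ.Admissible F 2 →
      ForSmallCouplings (datumOfRecord₁₃CoPH F 2 θ hP) fun g₀ => ∀ os : List (ULoop F),
        0 < (cr F θ hP g₀ os).l₀ ∧ 0 < (cr F θ hP g₀ os).vol ∧
        (∀ (K : ℕ) (t : ℝ), |t| ≤ (cr F θ hP g₀ os).l₀ →
          T4GenFunBounds.schemeZ ((datumOfRecord₁₃CoPH F 2 θ hP).scheme g₀) os ((cr F θ hP g₀ os).K₀ + K) t = ∑ τ ∈ (cr F θ hP g₀ os).T K, (cr F θ hP g₀ os).A K t τ) ∧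
        (∀ (K : ℕ) (t : ℝ), |t| ≤ (cr F θ hP g₀ os).l₀ →
          T4GenFunBounds.schemeZ ((datumOfRecord₁₃CoPH F 2 θ hP).scheme g₀) os ((cr F θ hP g₀ os).K₀ + K + 1) t = ∑ τ ∈ (cr F θ hP g₀ os).T K, (cr F θ hP g₀ os).B K t τ)) :
    Summit.QuantumFields.YangMills.Theses.BalabanUVNodes.SpineGivenEndpointR13SepCoPHV :=
  fun F θ h v hGd hθ _ _ =>
    hybridNE7Under_datumOfRecord₁₃SepCoPHV_of_guardedReadingN16_bFreeFaces_letters_trimmedLinkReading cr 𝔯 ksel ℓ ℓ₃ g B hβ1 hG16 hβw hlinkTrim hβ23 hs hL h9 hWall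
      hrBFree h20 h21 hxBFree F θ h v hGd hθ

end Slot

end Summit.QuantumFields.YangMills.BalabanUVNodes.N19KeyedCoreEdgeHolderD4SlotK3R8
end
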